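import Summits.ValiantsHypothesis.ValiantsHypothesis.Theorems.FifoMatchingNNDivisionHardExactPencilStickOut
import HarnessLib

/-!
# EXACT PENCILS XV — (E1) IN KERNEL FOR CUBES: four explicit reader families at a located pair `(Z, β)` (dead entries, row moves, column moves, transpose moves) and ★★★ `cor_add_fewGenCube_decided` (every cube with `N ≤ n − K(c,n)` generators is decided, NO hypothesis on the generators) (crux `NNDivisionHard`, stmt-ValiantsHypothesis-21181) — `ExactPencil` port part 15/15

Theorems-side port (staged by val-idea-40 g6, C′-census owner per director-valiant R331 (2)(e) / R336 (2) / desk #399 / #430 / #433, for the port hands;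
press as `Theorems/FifoMatchingNNDivisionHardExactPencilReadCube.lean`, `--kind proof --supports stmt-ValiantsHypothesis-21181 --as helper`, AFTER part 14,
at the desk's allocation) of val-idea-38 g3's `section ReadCube` = KERNEL FOOD #2 (bytes `pub/ideators/val-idea-38/ReadCube38_section.lean`, sha16 38b885de7a2263db,
155 l., 12 decls, 12/12 documented; KERNEL VERIFIED by val-idea-crit-9 g3 V#116c over the D1 scratch; re-certified here over the amended 14-part chain).
Declaration texts VERBATIM, placed in the port namespace `…Theorems.FifoMatching.ExactPencil` with §13b's `open` context (its author's scratch context).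
Part 15/15 of the port (imports part 14, `…Theorems.FifoMatchingNNDivisionHardExactPencilStickOut`).

* §13c `rowMove_faceZeroD`/`rowMove_read`, `colMove_faceZeroD`/`colMove_read`, `transposeMove_faceZeroD`/`transposeMove_read` (the three MOVE reader families,
  all `faceZeroD β D`; with the DEAD-ENTRY readers of part 10 = the four readers of (E1)/(E-5‴) for cubes), `read_of_offT` (a generator outside
  `T(Z,β) = {zero on dead rows/cols, block-row/column-constant, symmetric}` is read by one of the four), `cube_hw_of_read`, ★ `cor_add_bound_of_readCube`,
  ★★★ `cor_add_bound_of_cube_offT` (a cube is decided at `(Z,β)`: `3^{k−|D|} ≤ (r+1)·2^{k−|D|}` unless some nonzero generator lies in `T(Z,β)`), `exists_entry_ne_zero`,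
  ★★★ `cor_add_fewGenCube_decided` (`N ≤ n − K(c,n)` generators ⟹ `T c n < r`: one row index per nonzero generator is a hitting set `Z`; every generator sticks out of `Zᶜ × Zᶜ`;
  part 14's `cor_add_stickOutCube_decided`).

CURRENCY: C′ = `LocatedRows.ExactPencilLaw` = the exact-pencil form of COR-VIRTUAL (`exactPencilLaw_iff_corVirtualHardN` ✓ p688316, `…_iff_corVirtualHard` ✓ p688396).
HONEST LABEL: instance theorems (a DECIDED SPECIES, genus I) of the OPEN law C′ ≡ COR-VIRTUAL, plus the kernel form of enemy clause (E1)/(E-5‴) for cubes; the crux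
21181 `NNDivisionHard` is OPEN; `CoreLawFace`/`CoreLawOrb` OPEN; `LocatedPencilLaw` REFUTED (✓ p679540).  VP ≠ VNP is NOT proved here or anywhere in this tree.
-/

set_option autoImplicit false

-- the mandated summit-side namespace repeats a component by design (single-problem summit)
set_option linter.dupNamespace false

noncomputable section

open Matrix Finset
open scoped Pointwise

namespace Summit.ValiantsHypothesis.ValiantsHypothesis.Theorems.FifoMatching.ExactPencil

open Literature.Barriers.PneNP (HasEFOfSize)
open Literature.Combinatorics.Optimization.FixedSizePsdRank (corPolytope flat)
open Summit.ValiantsHypothesis.ValiantsHypothesis.Theorems.FifoMatching.XcDivision (udPt)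
open Summit.ValiantsHypothesis.ValiantsHypothesis.Theorems.FifoMatching.LocatedRows (T exactTilted cubePt flat_add' flat_sum')

/-! ### §13c (val-idea-38 g3) (E1) IN KERNEL FOR CUBES — four explicit reader families at a located pair `(Z, β)`:
DEAD ENTRIES `E_{xy}` (`β x ∈ D ∨ β y ∈ D`, rev 14), ROW MOVES `E_{xy} − E_{x'y}` (`β x = β x'`), COLUMN MOVES `E_{xy} − E_{xy'}`
(`β y = β y'`), TRANSPOSE MOVES `E_{xy} − E_{yx}` — all `faceZeroD β D`.  A cube is decided at `(Z, β)` (`3^{k−|D|} ≤ (r+1)·2^{k−|D|}`)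
unless some nonzero generator is UNREAD by all four, i.e. is zero on dead rows/columns, row- and column-constant inside every block and
symmetric = a member of `T(Z,β) = span{udPt (bUn β S) : S live}` in coordinates (crit-9 V#113b (E-5‴)/(E1) verbatim).  Corollary with NO
hypothesis on the generators: ★★★ `cor_add_fewGenCube_decided` — every cube with `N ≤ n − K(c,n)` generators is decided (hitting set of rows). -/

section ReadCube

variable {n : ℕ}

open Summit.ValiantsHypothesis.ValiantsHypothesis.Theorems.FifoMatching.LocatedRows (flat_sub')

/-- ROW MOVE reader: `E_{xy} − E_{x'y}` is `D`-face-zero whenever `x, x'` lie in a common block (live or dead). -/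
theorem rowMove_faceZeroD {k : ℕ} (β : Fin n → Fin k) (D : Finset (Fin k)) {x x' : Fin n} (y : Fin n) (h : β x = β x') :
    faceZeroD β D (Es x y - Es x' y) := by
  intro S _
  rw [flat_sub', sub_dotProduct, flat_Es_dotProduct_udPt, flat_Es_dotProduct_udPt]
  have hxx' : (x ∈ bUn β S ↔ x' ∈ bUn β S) := by rw [mem_bUn, mem_bUn, h]
  by_cases hx : x ∈ bUn β S
  · rw [if_pos hx, if_pos (hxx'.mp hx), sub_self]
  · rw [if_neg hx, if_neg (fun h' => hx (hxx'.mpr h')), sub_self]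

/-- the row move reads `g x y − g x' y`. -/
theorem rowMove_read (x x' y : Fin n) (g : Matrix (Fin n) (Fin n) ℝ) :
    flat (Es x y - Es x' y) ⬝ᵥ flat g = g x y - g x' y := by
  rw [flat_sub', sub_dotProduct, flat_Es_dotProduct_flat, flat_Es_dotProduct_flat]

/-- COLUMN MOVE reader: `E_{xy} − E_{xy'}` is `D`-face-zero whenever `y, y'` lie in a common block. -/
theorem colMove_faceZeroD {k : ℕ} (β : Fin n → Fin k) (D : Finset (Fin k)) (x : Fin n) {y y' : Fin n} (h : β y = β y') :
    faceZeroD β D (Es x y - Es x y') := by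
  intro S _
  rw [flat_sub', sub_dotProduct, flat_Es_dotProduct_udPt, flat_Es_dotProduct_udPt]
  have hyy' : (y ∈ bUn β S ↔ y' ∈ bUn β S) := by rw [mem_bUn, mem_bUn, h]
  by_cases hx : x ∈ bUn β S
  · by_cases hy : y ∈ bUn β S
    · simp only [if_pos hx, if_pos hy, if_pos (hyy'.mp hy), sub_self]
    · simp only [if_pos hx, if_neg hy, if_neg (fun h' => hy (hyy'.mpr h')), sub_self]
  · simp only [if_neg hx, sub_self]

/-- the column move reads `g x y − g x y'`. -/
theorem colMove_read (x y y' : Fin n) (g : Matrix (Fin n) (Fin n) ℝ) :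
    flat (Es x y - Es x y') ⬝ᵥ flat g = g x y - g x y' := by
  rw [flat_sub', sub_dotProduct, flat_Es_dotProduct_flat, flat_Es_dotProduct_flat]

/-- TRANSPOSE MOVE reader: `E_{xy} − E_{yx}` is `D`-face-zero for every `β`, `D`. -/
theorem transposeMove_faceZeroD {k : ℕ} (β : Fin n → Fin k) (D : Finset (Fin k)) (x y : Fin n) :
    faceZeroD β D (Es x y - Es y x) := by
  intro S _
  rw [flat_sub', sub_dotProduct, flat_Es_dotProduct_udPt, flat_Es_dotProduct_udPt]
  by_cases hx : x ∈ bUn β S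
  · by_cases hy : y ∈ bUn β S
    · rw [if_pos hx, if_pos hy, if_pos hy, if_pos hx, sub_self]
    · rw [if_pos hx, if_neg hy, if_neg hy, sub_self]
  · by_cases hy : y ∈ bUn β S
    · rw [if_neg hx, if_pos hy, if_neg hx, sub_self]
    · rw [if_neg hx, if_neg hy, sub_self]

/-- the transpose move reads `g x y − g y x`. -/
theorem transposeMove_read (x y : Fin n) (g : Matrix (Fin n) (Fin n) ℝ) :
    flat (Es x y - Es y x) ⬝ᵥ flat g = g x y - g y x := by
  rw [flat_sub', sub_dotProduct, flat_Es_dotProduct_flat, flat_Es_dotProduct_flat]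

/-- ★ OFF-`T(Z,β)` ⇒ READ: a matrix with a nonzero dead entry, or two unequal rows in a common block, or two unequal columns in a
common block, or an asymmetry, is read by a `D`-face-zero reader. -/
theorem read_of_offT {k : ℕ} (β : Fin n → Fin k) (D : Finset (Fin k)) (g : Matrix (Fin n) (Fin n) ℝ)
    (h : (∃ x y, g x y ≠ 0 ∧ (β x ∈ D ∨ β y ∈ D)) ∨ (∃ x x' y, β x = β x' ∧ g x y ≠ g x' y) ∨
      (∃ x y y', β y = β y' ∧ g x y ≠ g x y') ∨ (∃ x y, g x y ≠ g y x)) :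
    ∃ U, faceZeroD β D U ∧ flat U ⬝ᵥ flat g ≠ 0 := by
  rcases h with ⟨x, y, hg, hd⟩ | ⟨x, x', y, hb, hg⟩ | ⟨x, y, y', hb, hg⟩ | ⟨x, y, hg⟩
  · exact ⟨Es x y, Es_faceZeroD β D hd, by rwa [flat_Es_dotProduct_flat]⟩
  · exact ⟨Es x y - Es x' y, rowMove_faceZeroD β D y hb, by rwa [rowMove_read, sub_ne_zero]⟩
  · exact ⟨Es x y - Es x y', colMove_faceZeroD β D x hb, by rwa [colMove_read, sub_ne_zero]⟩
  · exact ⟨Es x y - Es y x, transposeMove_faceZeroD β D x y, by rwa [transposeMove_read, sub_ne_zero]⟩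

/-- a read generator makes both of its flips read. -/
theorem cube_hw_of_read {k N : ℕ} (β : Fin n → Fin k) (D : Finset (Fin k)) (Q₀ : Matrix (Fin n) (Fin n) ℝ)
    (G : Fin N → Matrix (Fin n) (Fin n) ℝ) (hG : ∀ t, G t ≠ 0 → ∃ U, faceZeroD β D U ∧ flat U ⬝ᵥ flat (G t) ≠ 0) :
    ∀ P, ∀ e ∈ cubeNbr P, cubeQ Q₀ G e ≠ cubeQ Q₀ G P →
      ∃ U, faceZeroD β D U ∧ flat U ⬝ᵥ flat (cubeQ Q₀ G e - cubeQ Q₀ G P) ≠ 0 := by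
  intro P e he hne
  unfold cubeNbr at he
  obtain ⟨t, -, rfl⟩ := Finset.mem_image.1 he
  have hd := cubeQ_flip_sub Q₀ G P t
  have hGt : G t ≠ 0 := by
    intro h0
    apply hne
    rw [← sub_eq_zero, hd, h0, neg_zero, ite_self]
  obtain ⟨U, hU, hne'⟩ := hG t hGt
  refine ⟨U, hU, ?_⟩
  rw [hd]
  split_ifs
  · have hneg : flat (-G t) = -flat (G t) := by
      funext p; simp [flat, Matrix.neg_apply]
    rw [hneg, dotProduct_neg]
    exact neg_ne_zero.2 hne'
  · exact hne'

/-- ★★★ **READ CUBES ARE DECIDED AT `(Z, β)`**: if every nonzero generator is read by some `D`-face-zero reader, then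
`3^{k−|D|} ≤ (r+1)·2^{k−|D|}` for every EF of size `r` of `COR(n) + cube` (★★★ `cor_add_bound_of_edgesReadD` + the cube cone certificate). -/
theorem cor_add_bound_of_readCube {k N : ℕ} {β : Fin n → Fin k} {σ : Fin k → Fin n} (hβσ : ∀ i, β (σ i) = i) (D : Finset (Fin k))
    (Q₀ : Matrix (Fin n) (Fin n) ℝ) (G : Fin N → Matrix (Fin n) (Fin n) ℝ)
    (hG : ∀ t, G t ≠ 0 → ∃ U, faceZeroD β D U ∧ flat U ⬝ᵥ flat (G t) ≠ 0) (r : ℕ)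
    (hEF : HasEFOfSize (corPolytope n + convexHull ℝ (Set.range (cubePt Q₀ G))) r) :
    3 ^ (k - D.card) ≤ (r + 1) * 2 ^ (k - D.card) := by
  rw [cubePt_eq_flat_cubeQ] at hEF
  exact cor_add_bound_of_edgesReadD hβσ D (cubeQ Q₀ G) cubeNbr (cube_hcone Q₀ G) (cube_hw_of_read β D Q₀ G hG) r hEF

/-- ★★★ **(E1) FOR CUBES, IN KERNEL**: a cube all of whose nonzero generators are OFF `T(Z,β)` — each has a nonzero dead entry, or two
unequal rows in a common block, or two unequal columns in a common block, or is not symmetric — is decided at `(Z, β)`.  Contrapositive =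
crit-9 (E-5‴)/(E1): an undecided cube carries a nonzero generator that is zero on dead rows/columns, block-constant and symmetric. -/
theorem cor_add_bound_of_cube_offT {k N : ℕ} {β : Fin n → Fin k} {σ : Fin k → Fin n} (hβσ : ∀ i, β (σ i) = i) (D : Finset (Fin k))
    (Q₀ : Matrix (Fin n) (Fin n) ℝ) (G : Fin N → Matrix (Fin n) (Fin n) ℝ)
    (hG : ∀ t, G t ≠ 0 → (∃ x y, G t x y ≠ 0 ∧ (β x ∈ D ∨ β y ∈ D)) ∨ (∃ x x' y, β x = β x' ∧ G t x y ≠ G t x' y) ∨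
      (∃ x y y', β y = β y' ∧ G t x y ≠ G t x y') ∨ (∃ x y, G t x y ≠ G t y x)) (r : ℕ)
    (hEF : HasEFOfSize (corPolytope n + convexHull ℝ (Set.range (cubePt Q₀ G))) r) :
    3 ^ (k - D.card) ≤ (r + 1) * 2 ^ (k - D.card) :=
  cor_add_bound_of_readCube hβσ D Q₀ G (fun t ht => read_of_offT β D (G t) (hG t ht)) r hEF

/-- a nonzero matrix has a nonzero entry. -/
theorem exists_entry_ne_zero {g : Matrix (Fin n) (Fin n) ℝ} (hg : g ≠ 0) : ∃ x y, g x y ≠ 0 := by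
  by_contra h
  simp only [not_exists, not_not] at h
  exact hg (Matrix.ext fun x y => by rw [h x y, Matrix.zero_apply])

/-- ★★★ **FEW GENERATORS ⇒ DECIDED** (no hypothesis on the generators): every affine cube passenger with `N ≤ n − K(c,n)` generators,
`K(c,n) = 2(log₂ n + c)^c + 6`, is decided — `T c n < r` for every EF of `COR(n) + cube`.  Proof: one row index per nonzero generator is a
hitting set `Z` with `|Z| ≤ N`; every nonzero generator sticks out of `ι × ι`, `ι = Zᶜ`, `|ι| ≥ n − N ≥ K(c,n)`; ★★★ `cor_add_stickOutCube_decided`. -/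
theorem cor_add_fewGenCube_decided (c : ℕ) {N : ℕ} (hN : N + (2 * (Nat.log 2 n + c) ^ c + 6) ≤ n)
    (Q₀ : Matrix (Fin n) (Fin n) ℝ) (G : Fin N → Matrix (Fin n) (Fin n) ℝ) (r : ℕ)
    (hEF : HasEFOfSize (corPolytope n + convexHull ℝ (Set.range (cubePt Q₀ G))) r) : T c n < r := by
  classical
  have hn : 0 < n := by omega
  have hrow : ∀ t, ∃ x : Fin n, G t ≠ 0 → ∃ y, G t x y ≠ 0 := by
    intro t
    by_cases ht : G t = 0
    · exact ⟨⟨0, hn⟩, fun h => (h ht).elim⟩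
    · obtain ⟨x, y, hxy⟩ := exists_entry_ne_zero ht
      exact ⟨x, fun _ => ⟨y, hxy⟩⟩
  choose row hrow using hrow
  set Z : Finset (Fin n) := Finset.univ.image row with hZ
  have hZcard : Z.card ≤ N := by
    calc Z.card ≤ (Finset.univ : Finset (Fin N)).card := Finset.card_image_le
      _ = N := by rw [Finset.card_univ, Fintype.card_fin]
  have hι : 2 * (Nat.log 2 n + c) ^ c + 6 ≤ Zᶜ.card := by
    rw [Finset.card_compl, Fintype.card_fin]
    omega
  refine cor_add_stickOutCube_decided c Zᶜ hι Q₀ G ?_ r hEF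
  intro t ht
  obtain ⟨y, hy⟩ := hrow t ht
  refine ⟨row t, y, hy, Or.inl ?_⟩
  rw [Finset.mem_compl, not_not, hZ]
  exact Finset.mem_image_of_mem row (Finset.mem_univ t)

end ReadCube

end Summit.ValiantsHypothesis.ValiantsHypothesis.Theorems.FifoMatching.ExactPencil
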